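import Summits.BirchSwinnertonDyer.BirchSwinnertonDyer.Theorems.PrintX11aMultOrbitDefs
import Summits.BirchSwinnertonDyer.BirchSwinnertonDyer.Theorems.PrintX11aMultThreeOrbitDecomposition
import Literature.NumberTheory.Automorphic.CongruenceSubgroupPropertySL2AwayHolds
import HarnessLib

/-!
# Crux `X11aLowerHalf` (item stmt-BirchSwinnertonDyer-19064), stub `stub_muAnDeepFive` side — the ATKIN–LEHNER-EXTENDED
# ORBIT SETUP in `GL₂(ℤ[1/p])` at `p ∥ N`, ANY prime `p`, part 2/3 ((h3), (h3′), (V))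

Cell `bsd-print-x11a`, width seat bsd-line-x11a-p1-w2 g3 (`--supports stmt-BirchSwinnertonDyer-19064`). BSD is not proved by
any of this; nothing is asserted about any curve. Pure group theory; see part 1/3 (`…MultOrbitDefs`) for the framing.  This is
the p-GENERIC form of bsd-line-x11a-p2 g2's `…MultThreeOrbitDecomposition` (there `p = 3`).

THIS FILE (2/3), for a level `N = pM` with `p` prime, `p ∤ M`, and `W = (px, y; pM, p)`, `px − My = 1`:
* COSET SPLITTING of `Γ₀(M)` modulo `Γ₀(pM)` (index `p + 1 = |P¹(𝔽_p)|`): `γ ∈ Γ₀(pM)` or `γ = γ₁ ξ' Tʲ`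
  (`exists_eq_mul_xiSL_mul_T_zpow`, `j = d c'` with `c c' ≡ 1 (p)` — THE one change w.r.t. `p = 3`, where `c' = c`);
  `γ = γ₁ (1 0; Mk 1)` or `γ = γ₁ ξ'` (`exists_eq_mul_lowerUnip_or_xiSL`, `k = c w`, `(dM) w ≡ 1 (p)`);
* (h3) `D* = Γ*·B*` and (h3′) `D* = Γ*·P*` (`deltaGL_eq_gammaStar_mul_upperGL/lowerGL`): scale the determinant away by
  `diag(1, det)`, apply the TREE's `deltaEqGamma0MulUpper/Lower` at `(p, M)`, then the coset splitting with
  `mapGL ξ' = W · diag(p,1)⁻¹` — `W` supplies exactly the missing transitivity on the cusp classes `[1/M]` and `[1/p]`;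
* (V) at `(p, M)` transported to `GL₂(ℤ[1/p])` (`mapGL_mem_closure_upper_lower`): Vaserstein's
  `G(A, MA) ≤ E(A, MA)` over `A = ℤ[1/p]` is the tree theorem `SL2Rel.Away.relG_le_relE_span_natCast`.
References: [Vaserstein1972SL2] Theorem; [Manin1972] Prop. 1.4; [Knapp1993] Lemma 9.24.
-/

set_option linter.dupNamespace false
set_option autoImplicit false

namespace Summit.BirchSwinnertonDyer.BirchSwinnertonDyer.Theorems.MultOrbit

open scoped MatrixGroups
open CongruenceSubgroup Matrix.SpecialLinearGroup
open Summit.BirchSwinnertonDyer.BirchSwinnertonDyer.Theorems.ConjSpanGenAllLevels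
  Literature.NumberTheory.EllipticCurves.Rank1Residual
-- the two `p`-independent `Γ₀(N)` bookkeeping lemmas of the `p = 3` file are reused, not restated
open Summit.BirchSwinnertonDyer.BirchSwinnertonDyer.Theorems.MultThreeOrbit (mem_Gamma0_of_dvd dvd_of_mem_Gamma0)

noncomputable section

/-! ### Coset splitting `Γ₀(M) = Γ₀(pM) ⊔ ⋃ⱼ Γ₀(pM)·ξ'·Tʲ` and the decompositions (h3), (h3') -/

section Cosets

variable {p N M : ℕ} {x y : ℤ} (hbez : (p : ℤ) * x - (M : ℤ) * y = 1) (hp : p.Prime) (hNM : N = p * M)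
  (hpM : ¬ p ∣ M)
include hp hNM hpM

omit hNM hpM in
/-- An inverse modulo a prime: `p ∣ 1 − c c'` for some `c'` when `p ∤ c`. [folklore] -/
theorem exists_dvd_one_sub_mul {c : ℤ} (hc : ¬ (p : ℤ) ∣ c) : ∃ c' : ℤ, (p : ℤ) ∣ 1 - c * c' := by
  haveI : Fact p.Prime := ⟨hp⟩
  have hz : (c : ZMod p) ≠ 0 := by
    rwa [Ne, ZMod.intCast_zmod_eq_zero_iff_dvd]
  refine ⟨(((c : ZMod p)⁻¹).val : ℤ), ?_⟩
  rw [← ZMod.intCast_zmod_eq_zero_iff_dvd]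
  push_cast
  rw [ZMod.natCast_zmod_val, mul_inv_cancel₀ hz, sub_self]

/-- `pM ∣ z` from `p ∣ z` and `M ∣ z` (`p ∤ M`). [folklore] -/
theorem dvd_N_of_dvd {z : ℤ} (hpz : (p : ℤ) ∣ z) (hM : (M : ℤ) ∣ z) : (N : ℤ) ∣ z := by
  have hcop : IsCoprime (p : ℤ) (M : ℤ) :=
    Nat.isCoprime_iff_coprime.mpr ((Nat.Prime.coprime_iff_not_dvd hp).mpr hpM)
  rw [hNM]; push_cast
  exact hcop.mul_dvd hpz hM

/-- **Coset splitting, `∞`-form** (index `p + 1`): every `γ ∈ Γ₀(M)` is `γ₁` or `γ₁ · ξ' · Tʲ` with `γ₁ ∈ Γ₀(pM)`,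
`j = d·c'` for an inverse `c'` of `c` modulo `p`. [folklore] -/
theorem exists_eq_mul_xiSL_mul_T_zpow (γ : SL(2, ℤ)) (hγ : γ ∈ Gamma0 M) :
    γ ∈ Gamma0 N ∨ ∃ j : ℤ, ∃ γ₁ ∈ Gamma0 N, γ = γ₁ * xiSL hbez * ModularGroup.T ^ j := by
  by_cases hpc : (p : ℤ) ∣ γ 1 0
  · exact Or.inl (mem_Gamma0_of_dvd (dvd_N_of_dvd hp hNM hpM hpc (dvd_of_mem_Gamma0 hγ)))
  · right
    obtain ⟨c', hc'⟩ := exists_dvd_one_sub_mul hp hpc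
    set c : ℤ := γ 1 0 with hc
    set d : ℤ := γ 1 1 with hd
    set j : ℤ := d * c' with hj
    set γ₁ : SL(2, ℤ) := γ * (ModularGroup.T ^ j)⁻¹ * (xiSL hbez)⁻¹ with hγ₁
    refine ⟨j, γ₁, mem_Gamma0_of_dvd ?_, by rw [hγ₁]; group⟩
    have h10 : (γ₁ 1 0 : ℤ) = (p : ℤ) * c - M * (d * (1 - c * c')) := by
      rw [hγ₁, Matrix.SpecialLinearGroup.coe_mul, Matrix.SpecialLinearGroup.coe_mul,
        Matrix.SpecialLinearGroup.coe_inv, Matrix.SpecialLinearGroup.coe_inv, ModularGroup.coe_T_zpow, xiSL]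
      simp [Matrix.mul_apply, Fin.sum_univ_two, Matrix.adjugate_fin_two, hj, hc, hd]
      ring
    rw [h10]
    refine dvd_N_of_dvd hp hNM hpM ?_ ?_
    · exact dvd_sub (dvd_mul_right (p : ℤ) c) (dvd_mul_of_dvd_right (dvd_mul_of_dvd_right hc' d) _)
    · exact dvd_sub (dvd_mul_of_dvd_right (dvd_of_mem_Gamma0 hγ) (p : ℤ)) (dvd_mul_right _ _)

/-- **Coset splitting, `0`-form**: every `γ ∈ Γ₀(M)` is `γ₁ · (1 0; Mk 1)` or `γ₁ · ξ'` with `γ₁ ∈ Γ₀(pM)`,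
`k = c·w` for an inverse `w` of `dM` modulo `p`. [folklore] -/
theorem exists_eq_mul_lowerUnip_or_xiSL (γ : SL(2, ℤ)) (hγ : γ ∈ Gamma0 M) :
    (∃ k : ℤ, ∃ γ₁ ∈ Gamma0 N, γ = γ₁ * lowerUnip ((M : ℤ) * k)) ∨
      ∃ γ₁ ∈ Gamma0 N, γ = γ₁ * xiSL hbez := by
  set c : ℤ := γ 1 0 with hc
  set d : ℤ := γ 1 1 with hd
  by_cases hpd : (p : ℤ) ∣ d
  · right
    set γ₁ : SL(2, ℤ) := γ * (xiSL hbez)⁻¹ with hγ₁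
    refine ⟨γ₁, mem_Gamma0_of_dvd ?_, by rw [hγ₁]; group⟩
    have h10 : (γ₁ 1 0 : ℤ) = (p : ℤ) * c - M * d := by
      rw [hγ₁, Matrix.SpecialLinearGroup.coe_mul, Matrix.SpecialLinearGroup.coe_inv, xiSL]
      simp [Matrix.mul_apply, Fin.sum_univ_two, Matrix.adjugate_fin_two, hc, hd]
      ring
    rw [h10]
    refine dvd_N_of_dvd hp hNM hpM ?_ ?_
    · exact dvd_sub (dvd_mul_right (p : ℤ) c) (dvd_mul_of_dvd_right hpd _)
    · exact dvd_sub (dvd_mul_of_dvd_right (dvd_of_mem_Gamma0 hγ) (p : ℤ)) (dvd_mul_right _ _)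
  · left
    have hMd : ¬ (p : ℤ) ∣ d * M := by
      intro h
      rcases ((Nat.prime_iff_prime_int.mp hp).dvd_or_dvd h) with h | h
      · exact hpd h
      · exact hpM (by exact_mod_cast h)
    obtain ⟨w, hw⟩ := exists_dvd_one_sub_mul hp hMd
    set k : ℤ := c * w with hk
    set γ₁ : SL(2, ℤ) := γ * (lowerUnip ((M : ℤ) * k))⁻¹ with hγ₁
    refine ⟨k, γ₁, mem_Gamma0_of_dvd ?_, by rw [hγ₁]; group⟩
    have h10 : (γ₁ 1 0 : ℤ) = c * (1 - (d * M) * w) := by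
      rw [hγ₁, Matrix.SpecialLinearGroup.coe_mul, Matrix.SpecialLinearGroup.coe_inv, lowerUnip]
      simp [Matrix.mul_apply, Fin.sum_univ_two, Matrix.adjugate_fin_two, hk, hc, hd]
      ring
    rw [h10]
    refine dvd_N_of_dvd hp hNM hpM ?_ ?_
    · exact dvd_mul_of_dvd_right hw c
    · exact dvd_mul_of_dvd_left (dvd_of_mem_Gamma0 hγ) _

omit hp hNM hpM in
/-- `mapGL ξ' = W · diag(p,1)⁻¹`. [folklore] -/
theorem mapGL_xiSL_eq : (mapGL (A p) (xiSL hbez) : G p) = WA hbez * (dP1 p)⁻¹ := by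
  rw [WA, mul_inv_cancel_right]

omit hp hNM hpM in
/-- `mapGL Tʲ ∈ B*`. [folklore] -/
theorem mapGL_T_zpow_mem_upperGL (j : ℤ) : (mapGL (A p) (ModularGroup.T ^ j) : G p) ∈ upperGL p := by
  show ((mapGL (A p) (ModularGroup.T ^ j) : G p) : Matrix (Fin 2) (Fin 2) (A p)) 1 0 = 0
  rw [coe_mapGL_int, ModularGroup.coe_T_zpow]
  simp

omit hp hNM hpM in
/-- `mapGL (1 0; Mk 1) ∈ P*_M`. [folklore] -/
theorem mapGL_lowerUnip_mem_lowerGL (k : ℤ) : (mapGL (A p) (lowerUnip ((M : ℤ) * k)) : G p) ∈ lowerGL p M := by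
  refine ⟨?_, (k : A p), ?_⟩
  · show ((mapGL (A p) (lowerUnip ((M : ℤ) * k)) : G p) : Matrix (Fin 2) (Fin 2) (A p)) 0 1 = 0
    rw [coe_mapGL_int, lowerUnip]; simp
  · show ((mapGL (A p) (lowerUnip ((M : ℤ) * k)) : G p) : Matrix (Fin 2) (Fin 2) (A p)) 1 0 = _
    rw [coe_mapGL_int, lowerUnip]; simp

omit hp hNM hpM in
/-- `toGL ∘ ι = mapGL`. [folklore] -/
theorem toGL_iota (γ : SL(2, ℤ)) : (toGL (iota p γ) : G p) = mapGL (A p) γ := by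
  apply Matrix.GeneralLinearGroup.ext
  intro i j
  rw [Matrix.SpecialLinearGroup.coe_GL_coe_matrix, coe_mapGL_int]
  simp

/-- **(h3) `D* = Γ*·B*`.** [folklore] -/
theorem deltaGL_eq_gammaStar_mul_upperGL {g : G p} (hg : g ∈ DeltaGL p M) :
    ∃ γs ∈ GammaStar N hbez, ∃ b ∈ upperGL p, g = γs * b := by
  obtain ⟨t, ht⟩ := hg
  set u : (A p)ˣ := Matrix.GeneralLinearGroup.det g with hu
  set g' : G p := g * (diag2 1 u)⁻¹ with hg'
  have hdet' : Matrix.det (g' : Matrix (Fin 2) (Fin 2) (A p)) = 1 := by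
    rw [← Matrix.GeneralLinearGroup.val_det_apply, hg', map_mul, map_inv, det_diag2, one_mul, ← hu,
      mul_inv_cancel, Units.val_one]
  set g'' : SL(2, A p) := ⟨(g' : Matrix (Fin 2) (Fin 2) (A p)), hdet'⟩ with hg''
  have hgg : (toGL g'' : G p) = g' := Units.ext rfl
  have h10 : g'' 1 0 = (M : A p) * t := by
    show (g' : Matrix (Fin 2) (Fin 2) (A p)) 1 0 = _
    rw [hg', Matrix.GeneralLinearGroup.coe_mul, Matrix.mul_apply, Fin.sum_univ_two]
    have h1 : (((diag2 1 u)⁻¹ : G p) : Matrix (Fin 2) (Fin 2) (A p)) 0 0 = 1 := rfl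
    have h2 : (((diag2 1 u)⁻¹ : G p) : Matrix (Fin 2) (Fin 2) (A p)) 1 0 = 0 := rfl
    rw [h1, h2, ht]; ring
  obtain ⟨γ, hγ, b, hb, hdec⟩ :=
    deltaEqGamma0MulUpper (p := p) (N := M) hp hpM g'' ⟨t, h10⟩
  have hg_eq : g = mapGL (A p) γ * (toGL b * diag2 1 u) := by
    have : g = g' * diag2 1 u := by rw [hg', inv_mul_cancel_right]
    rw [this, ← hgg, hdec, map_mul, toGL_iota, mul_assoc]
  rcases exists_eq_mul_xiSL_mul_T_zpow hbez hp hNM hpM γ hγ with hγN | ⟨j, γ₁, hγ₁, hγeq⟩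
  · exact ⟨mapGL (A p) γ, mapGL_mem_GammaStar hbez ⟨γ, hγN⟩, toGL b * diag2 1 u,
      mul_mem (toGL_mem_upperGL hb) (diag2_mem_upperGL 1 u), hg_eq⟩
  · refine ⟨mapGL (A p) γ₁ * WA hbez, mul_mem (mapGL_mem_GammaStar hbez ⟨γ₁, hγ₁⟩) (WA_mem_GammaStar hbez),
      (dP1 p)⁻¹ * mapGL (A p) (ModularGroup.T ^ j) * (toGL b * diag2 1 u),
      mul_mem (mul_mem (inv_mem (diag2_mem_upperGL (pU p) 1)) (mapGL_T_zpow_mem_upperGL j))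
        (mul_mem (toGL_mem_upperGL hb) (diag2_mem_upperGL 1 u)), ?_⟩
    rw [hg_eq, hγeq, map_mul, map_mul, mapGL_xiSL_eq]
    simp only [mul_assoc]

/-- **(h3') `D* = Γ*·P*`.** [folklore] -/
theorem deltaGL_eq_gammaStar_mul_lowerGL {g : G p} (hg : g ∈ DeltaGL p M) :
    ∃ γs ∈ GammaStar N hbez, ∃ q ∈ lowerGL p M, g = γs * q := by
  obtain ⟨t, ht⟩ := hg
  set u : (A p)ˣ := Matrix.GeneralLinearGroup.det g with hu
  set g' : G p := g * (diag2 1 u)⁻¹ with hg'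
  have hdet' : Matrix.det (g' : Matrix (Fin 2) (Fin 2) (A p)) = 1 := by
    rw [← Matrix.GeneralLinearGroup.val_det_apply, hg', map_mul, map_inv, det_diag2, one_mul, ← hu,
      mul_inv_cancel, Units.val_one]
  set g'' : SL(2, A p) := ⟨(g' : Matrix (Fin 2) (Fin 2) (A p)), hdet'⟩ with hg''
  have hgg : (toGL g'' : G p) = g' := Units.ext rfl
  have h10 : g'' 1 0 = (M : A p) * t := by
    show (g' : Matrix (Fin 2) (Fin 2) (A p)) 1 0 = _
    rw [hg', Matrix.GeneralLinearGroup.coe_mul, Matrix.mul_apply, Fin.sum_univ_two]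
    have h1 : (((diag2 1 u)⁻¹ : G p) : Matrix (Fin 2) (Fin 2) (A p)) 0 0 = 1 := rfl
    have h2 : (((diag2 1 u)⁻¹ : G p) : Matrix (Fin 2) (Fin 2) (A p)) 1 0 = 0 := rfl
    rw [h1, h2, ht]; ring
  obtain ⟨γ, hγ, q, hq, hdec⟩ :=
    deltaEqGamma0MulLower (p := p) (N := M) hp hpM g'' ⟨t, h10⟩
  have hg_eq : g = mapGL (A p) γ * (toGL q * diag2 1 u) := by
    have : g = g' * diag2 1 u := by rw [hg', inv_mul_cancel_right]
    rw [this, ← hgg, hdec, map_mul, toGL_iota, mul_assoc]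
  rcases exists_eq_mul_lowerUnip_or_xiSL hbez hp hNM hpM γ hγ with ⟨k, γ₁, hγ₁, hγeq⟩ | ⟨γ₁, hγ₁, hγeq⟩
  · refine ⟨mapGL (A p) γ₁, mapGL_mem_GammaStar hbez ⟨γ₁, hγ₁⟩,
      mapGL (A p) (lowerUnip ((M : ℤ) * k)) * (toGL q * diag2 1 u),
      mul_mem (mapGL_lowerUnip_mem_lowerGL k) (mul_mem (toGL_mem_lowerGL hq) (diag2_mem_lowerGL M 1 u)), ?_⟩
    rw [hg_eq, hγeq, map_mul]
    simp only [mul_assoc]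
  · refine ⟨mapGL (A p) γ₁ * WA hbez, mul_mem (mapGL_mem_GammaStar hbez ⟨γ₁, hγ₁⟩) (WA_mem_GammaStar hbez),
      (dP1 p)⁻¹ * (toGL q * diag2 1 u),
      mul_mem (inv_mem (diag2_mem_lowerGL M (pU p) 1))
        (mul_mem (toGL_mem_lowerGL hq) (diag2_mem_lowerGL M 1 u)), ?_⟩
    rw [hg_eq, hγeq, map_mul, mapGL_xiSL_eq]
    simp only [mul_assoc]

end Cosets

/-! ### (V) at `(p, M)`: `mapGL γ ∈ ⟨B* ∪ P*_M⟩` for `γ ∈ Γ_H(M)` (Vaserstein over `ℤ[1/p]`, a tree theorem) -/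

section Vaserstein

variable {p M : ℕ}

/-- **(V) transported to `GL₂(ℤ[1/p])`**: for a prime `p`, `M ≥ 1` and `γ ∈ Γ₀(M)` with `d ≡ ±pᵏ (mod M)`,
`mapGL γ ∈ ⟨B* ∪ P*_M⟩` — Vaserstein's `G(A, MA) ≤ E(A, MA)` over `A = ℤ[1/p]` (tree theorem
`SL2Rel.Away.relG_le_relE_span_natCast`), the tree's `(V) ⟹ (E′)` step, and `toGL`.
[cite: Vaserstein1972SL2, Theorem, p. 313] -/
theorem mapGL_mem_closure_upper_lower (hp : p.Prime) (hM : 0 < M) (γ : Gamma0 M) (hγ : InGammaH M p γ) :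
    (mapGL (A p) (γ : SL(2, ℤ)) : G p) ∈ Subgroup.closure ((upperGL p : Set (G p)) ∪ (lowerGL p M : Set (G p))) := by
  have hV : RelGLeRelE p M := relG_top_le_relE_top_of_relG_le_relE _
    (Literature.NumberTheory.Automorphic.SL2Rel.Away.relG_le_relE_span_natCast p hp.two_le M hM.ne')
  have h := iota_mem_closure_of_relGLeRelE (p := p) (N := M) hp hV γ hγ
  have h2 := Subgroup.mem_map_of_mem (toGL : SL(2, A p) →* G p) h
  rw [MonoidHom.map_closure, toGL_iota] at h2
  refine Subgroup.closure_mono ?_ h2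
  rintro _ ⟨b, hb | hb, rfl⟩
  · exact Or.inl (toGL_mem_upperGL hb)
  · exact Or.inr (toGL_mem_lowerGL hb)

end Vaserstein

end

end Summit.BirchSwinnertonDyer.BirchSwinnertonDyer.Theorems.MultOrbit
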